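import Literature.MathematicalPhysics.QuantumFieldTheory.BalabanImbrieJaffe1984to88.BIJ88W6PrimeVsuppLoc
import Literature.MathematicalPhysics.QuantumFieldTheory.BalabanImbrieJaffe1984to88.BIJ88Eq5145CornerW6

/-!
# `BalabanImbrieJaffe1984to88.BIJ88Eq5145CornerW6Loc` — T. Bałaban, J. Imbrie, A. Jaffe, *Effective action and cluster properties of the abelian
Higgs model*, Commun. Math. Phys. **114** (1988) 257–315 [BalabanImbrieJaffe1988], Sect. 5.14, (5.14.5) p. 312 [PDF 56] with (5.14.4) p. 309 and
p. 310 display 4: **THE C2.Eq5.14.5 HEAD THEOREM RE-DERIVED FROM THE LEAF (5.14.4) IN THE LOCATED READING WITH NO BASE-POINT BINDER, AND KERNEL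
WITNESSES THAT THE LANDED HEAD'S HYPOTHESES ARE UNSATISFIABLE** (GAPS G-C2-p36-07; p. 309: *"Here H_β ⊂ H specifies which (d/dt)_{γ_j} have supports
intersecting X_β"*) — for two independent reasons: №1 the leaf in the UNLOCATED instantiation (`false_of_h5144`), №2 the base-point binder
`s₀ : (ρ : Finset (Finset I)) → slots of lam12 W ρ`, uninhabitable at `ρ = {W}` (`false_of_s0`).

statement-level skeleton of published theorems with citation tags; proofs where landed; nothing here is a claim about the Yang–Mills mass gap

* §1 **`false_of_h5144`** — in the EXACT hypothesis shape of the landed head theorem of record `BIJ88Eq5145CornerW6.eq5145_zG_mod_W6v_of_ineq5144`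
  (the leaf in the UNLOCATED instantiation `Ineq5144 (cubeSys I) (Finset L′) (actIn … X′ t γ′) card (H X″ ↦ |X″ ∖ (cubeIn X′ ∘ γ′) H|) θ β′` for the
  located data of EVERY sub-region `X′ ⊆ Λ₁₂` at every `t ∈ (0,1]` and every assignment `γ′`): if some admissible `ρ` has a cube `i₀ ∈ Λ₁₂ = lam12 W ρ`
  carrying a located slot `τ₀` and there is a second cube `i₁ ≠ i₀`, then `{hθ0, hθ1, hβ, hsmall, hΔ, h5144}` prove `False` — at `X′ = {i₀}`,
  `γ′ ≡ τ₀`, `t = 1`, `(H, X″) = ({l₀}, {i₁})` the activity is the expectation of the EMPTY product over the (probability) law of `□_{i₁}`, `= 1`,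
  while the leaf demands `≤ θ^{1+β′}`, so `θ ≥ 1`, contradicting gen 5's regime `16(D+1)²e²θ^{β′/2} ≤ 1`.  Hence the landed head is VACUOUS in
  every instance with two cubes and one slot inside an admissible region; **`false_of_s0`** — the binder `s₀` alone proves `False` (at `ρ = {W}`,
  `Λ₁₂ = ∅` has no slot).
* §2 located twins WITHOUT the binder `s₀` (a located slot is chosen where one exists; a slot-free region is treated directly), VERBATIM
  conclusions, of gen 13's `BIJ88Eq5145CornerModulus.eq5145_zG_mod_Tsum_of_ineq5144` / `…_remR_of_ineq5144` (both
  χ-species of p. 308, no centring, every source `ℱ`): the leaf BY NAME on the located activity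
  `locAct (cubeIn cube Λ₁₂ ∘ γ′) (prime (g3 adj (H′ ↦ zG …)))` (`BIJ88Ineq5144Located.ineq5144_locAct_iff` = the support-conditioned (5.14.4)).
* §3 **`eq5145_zG_mod_W6v_of_ineq5144_loc`** — THE HEAD THEOREM (exponent `exp(−𝒫^L − Σ_X (W₆′(X) + W₆″(X)))`, `W₆′ = W6v` as printed, display 4
  derived inside) from the located leaf for the located data of every sub-region of `Λ₁₂`; **`ineqW6'_W6v_region_loc`** — r16's `IneqW6'` for that
  `W₆′`, region by region.  Proofs = the landed ones with every leaf lemma replaced by its located twin (siblings `BIJ88Ineq5144Located`,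
  `BIJ88SlotConnectedGraph310KPLoc`, `BIJ88W6PrimeVsuppLoc`); each twin implies its landed original (`ineq5144_locAct_of_unlocated`).

PDF held: `paper:balaban1988-cmp114-bij-abelian-higgs-effective-action` (journal page = PDF page + 256); pp. 309–312 = PDF 53–56 read this session.
HONEST SCOPE: (5.14.4) is NOT proved (r16's typed leaf `Ineq5144`, now in the print's located reading — a genuine, satisfiable smallness hypothesis on
the data); `W₆″`, `𝒫^L` enter through `h311` (r16's p. 311 lineage); the `(n̄+1)!` slip G-C2-p36-06; gen 5's regime and p25's adjusted exponents;
finite-dimensional real Gaussian model of §5.13.  0 `sorry`, 0 definitions, 0 `Prop` facts (D-0026); imports `BIJ88W6PrimeVsuppLoc` (p36 g14),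
`BIJ88Eq5145CornerW6` (p36 g13); modifies nothing.  NOT summit progress; NOT continuum; NOT Clay.  Cell `lit-balaban` Phase 2, seat p36 gen 14 (rows
C2.Eq5.14.5 / C2.Claim@310 member cells, owner r16 — the head pointer is r16's call; referee ref-5).
-/

noncomputable section

open Finset MeasureTheory
open Literature.MathematicalPhysics.QuantumFieldTheory.BalabanImbrieJaffe1984to88
open BIJ88DirichletForms305 (interpForm interpForm_posDef)
open BIJ88PolymerRep5134 (g1 g1_singleton IsAdmissible corner corner_apply)
open BIJ88PolymerRep5134Gauss (ext obs expect zG)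
open BIJ88Resummation5141 (outer lam12)
open BIJ88Resummation5141Adm (lam12')
open BIJ88Expansion5143 (g3 prime prime_of_not)
open BIJ88Expansion5143Gauss (fD)
open BIJ88Expansion5143Ordered (polysOf cvsupp locv wv)
open BIJ88ConnectedGraphResummation (Tsum)
open BIJ88SlotMoments308 (zt)
open BIJ88SlotMomentsGauss308 (uD)
open BIJ88Sect5Statements (CutoffProfile)
open BIJ88Sect5StatementsPart2 (Ineq5144 IneqW6')
open BIJ88Sect5StatementsPart4 (remR pertP)
open BIJ88Ineq5113Covering (cubeSys)
open BIJ88Eq5145CornerModel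
open BIJ88Eq5145CornerUrsell (cubeIn cubeIn_mem interpForm_abutting ztIn_eq_zG_located)
open BIJ88Eq5145Remainder (sum_add_ite_eq)
open BIJ88GaussShellModulus309 (continuous_and_zero_of_mod)
open BIJ88W6PrimeVsupp (actIn W6v)
open BIJ88W6PrimeVsuppBound (W6v_eq_zero_of_not_subset card_filter_cubeIn_le)
open BIJ88Ineq5144Located (locAct)
open BIJ88SlotConnectedGraph310KPLoc (effectiveAction_fieldLaw_eq_pertP_add_remR_Tsum_of_ineq5144_mod_loc)
open BIJ88W6PrimeVsuppLoc (remR_sum_Tsum_eq_sum_W6v_loc ineqW6'_W6v_loc)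

namespace Literature.MathematicalPhysics.QuantumFieldTheory.BalabanImbrieJaffe1984to88.BIJ88Eq5145CornerW6Loc

variable {α I : Type} [Fintype α] [DecidableEq α] [Fintype I] [DecidableEq I]
  (blk : α → I) (Δ : Matrix α α ℝ) (ℱ : α → ℝ)
variable (adj : I → I → Prop) [DecidableRel adj]
variable (χ : CutoffProfile) {ι υ : Type*} [DecidableEq ι] [DecidableEq υ]
variable {p ek : ℝ} {B : Finset ι} {Φ : ι → (α → ℝ) → ℝ} {c : ι → ℝ} {Ys : Finset υ} {V : υ → (α → ℝ) → ℝ}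
variable (cube : ↥B ⊕ ↥Ys → I) {L : Type*} (γ : L → ↥B ⊕ ↥Ys)

/-! ## §1 The landed head theorem's hypotheses are unsatisfiable (two independent witnesses) -/

/-- **KERNEL WITNESS (GAPS G-C2-p36-07): THE HYPOTHESIS FAMILY OF THE LANDED HEAD THEOREM `BIJ88Eq5145CornerW6.eq5145_zG_mod_W6v_of_ineq5144` PROVES
`False`** in every instance with an admissible region `ρ`, a cube `i₀ ∈ Λ₁₂ = lam12 W ρ` carrying a located slot `τ₀`, and a second cube `i₁ ≠ i₀`:
its `h5144` (the leaf (5.14.4) in the UNLOCATED instantiation, for the located data of every sub-region of `Λ₁₂`, every `t ∈ (0,1]`, every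
assignment) at `X′ = {i₀}`, `γ′ ≡ τ₀`, `t = 1`, `(H, X″) = ({l₀}, {i₁})` bounds the expectation of the EMPTY product over the law of the fields of
`□_{i₁}` — which is `1` (`Δ ≻ 0`: a probability measure) — by `θ^{1+β′} ≤ θ`, so `θ ≥ 1`, while `16(D+1)²e²θ^{β′/2} ≤ 1` with `θ = 1` is absurd.  The
print is not at fault (p. 309 *"H_β ⊂ H specifies which (d/dt)_{γ_j} have supports intersecting X_β"*): §3 re-derives the head from the located leaf.
[cite: BalabanImbrieJaffe1988, (5.14.4) p.309; (5.14.5) p.312] -/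
theorem false_of_h5144 {D : ℕ} {θ β' : ℝ} (hθ0 : 0 < θ) (hθ1 : θ ≤ 1) (hβ : 0 ≤ β')
    (hsmall : 16 * ((D : ℝ) + 1) ^ 2 * (θ ^ (β' / 2) * Real.exp 2) ≤ 1) (hΔ : Δ.PosDef)
    {L' : Type} [Fintype L'] [DecidableEq L'] [Nonempty L'] (W Bl : Finset I)
    {ρ : Finset (Finset I)} (hρ : ρ ∈ (outer W Bl).filter (IsAdmissible adj)) {i₀ : I} (hi₀ : i₀ ∈ lam12 W ρ)
    (τ₀ : ↥(slotB B Ys cube {i₀}) ⊕ ↥(slotY B Ys cube {i₀})) {i₁ : I} (hi₁ : i₁ ≠ i₀)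
    (h5144 : ∀ ρ ∈ (outer W Bl).filter (IsAdmissible adj), ∀ X' ⊆ lam12 W ρ, ∀ t ∈ Set.Ioc (0 : ℝ) 1,
      ∀ γ' : L' → ↥(slotB B Ys cube X') ⊕ ↥(slotY B Ys cube X'),
      Ineq5144 (cubeSys I) (Finset L') (actIn blk Δ ℱ adj χ p ek B Φ c Ys V cube (lam12' adj W ρ) X' t γ')
        Finset.card (fun H (X'' : Finset I) => (X'' \ H.image (cubeIn cube X' ∘ γ')).card) θ β') : False := by
  classical
  obtain ⟨l₀⟩ := ‹Nonempty L'›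
  have h := h5144 ρ hρ {i₀} (singleton_subset_iff.2 hi₀) 1 ⟨one_pos, le_rfl⟩ (fun _ => τ₀) {l₀} ({i₁} : Finset I)
  dsimp only at h
  -- the cube of `τ₀` is `i₀`, so `X″ ∖ loc(H) = {i₁}`
  have hτ₀ : cubeIn cube {i₀} τ₀ = i₀ := mem_singleton.1 (cubeIn_mem cube {i₀} τ₀)
  have hsd : (({i₁} : Finset I) \ ({l₀} : Finset L').image (cubeIn cube {i₀} ∘ fun _ : L' => τ₀)) = {i₁} := by
    rw [image_singleton, Function.comp_apply, hτ₀, sdiff_singleton_eq_erase]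
    exact erase_eq_of_notMem (by simpa using fun h => hi₁ h.symm)
  -- the activity of `({l₀}, {i₁})`: no located slot of `{i₀}` sits in `□_{i₁}`, the observable is the empty product, the law is a probability measure
  have hΔΛ : (interpForm blk Δ (corner ℝ (lam12' adj W ρ))).PosDef :=
    interpForm_posDef blk hΔ fun i => by rw [corner_apply]; split_ifs <;> norm_num
  haveI := isProbabilityMeasure_regionLaw blk (interpForm blk Δ (corner ℝ (lam12' adj W ρ))) ℱ hΔΛ ({i₁} : Finset I) {i₁}
  have hfil : (univ.filter fun τ : ↥(slotB B Ys cube {i₀}) ⊕ ↥(slotY B Ys cube {i₀}) => cubeIn cube {i₀} τ = i₁) = ∅ :=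
    filter_eq_empty_iff.2 fun τ _ hτ => hi₁ (hτ.symm.trans (mem_singleton.1 (cubeIn_mem cube {i₀} τ)))
  have hact : actIn blk Δ ℱ adj χ p ek B Φ c Ys V cube (lam12' adj W ρ) {i₀} 1 (fun _ : L' => τ₀) {l₀} {i₁} = 1 := by
    simp only [actIn, prime, singleton_ne_empty, false_and, if_false, sub_zero, g3, g1_singleton]
    rw [zG_eq_integral_regionLaw]
    have hobs : ∀ φ, obs blk (fD (uD χ p ek (slotB B Ys cube {i₀}) (fun b : ↥B => Φ b) (fun b : ↥B => c b) (slotY B Ys cube {i₀})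
        (fun Y : ↥Ys => V Y) 1) (cubeIn cube {i₀}) (fun _ : L' => τ₀) {l₀}) {i₁} φ = 1 := fun φ => by
      simp only [obs, prod_singleton, fD, hfil, prod_empty]
    simp only [hobs, integral_const, smul_eq_mul, mul_one, probReal_univ]
  rw [hact, hsd, card_singleton, card_singleton, abs_one, Nat.cast_one, mul_one] at h
  -- `1 ≤ θ^{1+β′} ≤ θ ≤ 1`, hence `θ = 1`, contradicting the regime
  have h2 : θ ^ ((1 : ℝ) + β') ≤ θ ^ (1 : ℝ) := Real.rpow_le_rpow_of_exponent_ge hθ0 hθ1 (by linarith)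
  rw [Real.rpow_one] at h2
  have hθ : θ = 1 := le_antisymm hθ1 (h.trans h2)
  rw [hθ, Real.one_rpow, one_mul] at hsmall
  have he : (1 : ℝ) < Real.exp 2 := Real.one_lt_exp_iff.2 (by norm_num)
  have hD : (1 : ℝ) ≤ ((D : ℝ) + 1) ^ 2 := by
    have : (1 : ℝ) ≤ (D : ℝ) + 1 := by linarith [(Nat.cast_nonneg D : (0 : ℝ) ≤ D)]
    nlinarith
  nlinarith

omit [Fintype I] [DecidableEq ι] [DecidableEq υ] in
/-- **KERNEL WITNESS №2: THE BASE-POINT BINDER OF THE LANDED HEAD THEOREMS IS UNINHABITABLE.** The landed (5.14.5) heads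
(`BIJ88Eq5145CornerUrsell` … `BIJ88Eq5145CornerW6`) display a located slot `s₀ ρ` of `Λ₁₂ = lam12 W ρ` for EVERY family `ρ : Finset (Finset I)`;
at `ρ = {W}` the region `lam12 W {W} = W ∖ W` is empty and carries no slot, so the binder's type is empty and every theorem carrying it is vacuous
(independently of №1).  §2–§3 below display NO base point: a slot-free region is treated directly (`z_t ≡ 1`, no assignments, `𝒫 = 0 = ℛ`).
[cite: BalabanImbrieJaffe1988, (5.14.2) p.308; p.306 (Sect. 5.13)] -/
theorem false_of_s0 (W : Finset I) (s₀ : (ρ : Finset (Finset I)) → ↥(slotB B Ys cube (lam12 W ρ)) ⊕ ↥(slotY B Ys cube (lam12 W ρ))) :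
    False := by
  have h0 : lam12 W {W} = ∅ := by simp [lam12]
  rcases s₀ {W} with b | Y
  · exact absurd ((Finset.ext_iff.1 h0 _).1 ((mem_slotB B Ys cube _ _).1 b.2)) (notMem_empty _)
  · exact absurd ((Finset.ext_iff.1 h0 _).1 ((mem_slotY B Ys cube _ _).1 Y.2)) (notMem_empty _)

/-! ## §2 (5.14.5) on the model for both χ-species, from the located leaf (gen 13 `BIJ88Eq5145CornerModulus`) -/

/-- **(5.14.5) ON THE MODEL FOR BOTH χ-SPECIES, REMAINDER AS THE CONNECTED-GRAPH SERIES OF DISPLAY 3 MODULO THE LEAF (5.14.4) — NO MEAN-FIELD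
CONDITION**: gen 12's `BIJ88Eq5145CornerNoncentred.eq5145_zG_linear_Tsum_of_ineq5144'` with `hlin` WEAKENED to `hmod`: per region `Λ₁₂` at
`1_{Λ₁₂′}`, `hlogz` DISCHARGED by `BIJ88GaussShellModulus309.effectiveAction_fieldLaw_eq_pertP_add_remR_Tsum_of_ineq5144_mod_loc` for the located slot
data (`slotB`, `slotY`, `cubeIn`) and the resummed form `Δ_{1_{Λ₁₂′}}` (a slot-free region directly: `z_t ≡ 1`, `𝒫 = 0 = ℛ`); displayed per region
(NO base point `s₀`): THE LEAF (5.14.4) for the located prime-dropped activities of every assignment at every `t ∈ (0,1]` (`h5144`, gen 5's regime),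
`hrem` (display 4: `(n̄+1)·remR(Σ_γ T) = Σ_X W₆′(X)`) and `h311`.
[cite: BalabanImbrieJaffe1988, (5.14.5) p.312; (5.14.2) p.308; p.310 displays 3–4; (5.14.4) p.309] -/
theorem eq5145_zG_mod_Tsum_of_ineq5144_loc {nbr : I → Finset I} {D : ℕ} {θ β' : ℝ} (hR : ∀ x y, adj x y → adj y x)
    (hD : ∀ x, (nbr x).card ≤ D) (hnbr : ∀ x y, adj x y → y ∈ nbr x) (hθ0 : 0 < θ) (hθ1 : θ ≤ 1) (hβ : 0 ≤ β')
    (hsmall : 16 * ((D : ℝ) + 1) ^ 2 * (θ ^ (β' / 2) * Real.exp 2) ≤ 1)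
    (hΔadj : ∀ x y, blk x ≠ blk y → ¬ adj (blk x) (blk y) → Δ x y = 0) (hΔ : Δ.PosDef)
    (hχ : ∀ x, 0 ≤ χ.χ₁ x) (hp : 1 / 2 < p)
    (hmod : ∀ b ∈ B, ∃ ℓ₁ ℓ₂ : (α → ℝ) → ℝ, IsLinearMap ℝ ℓ₁ ∧ IsLinearMap ℝ ℓ₂ ∧
      ((∀ φ, Φ b φ = ℓ₁ φ) ∨ (∀ φ, Φ b φ = Real.sqrt (ℓ₁ φ ^ 2 + ℓ₂ φ ^ 2))))
    {c₀ : ℝ} (hc₀ : 0 < c₀) (hcb : ∀ b ∈ B, c₀ ≤ c b) (hV : ∀ Y ∈ Ys, Measurable (V Y)) {KY : υ → ℝ} (hK : ∀ Y ∈ Ys, ∀ φ, |V Y φ| ≤ KY Y)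
    (hek : 0 < ek) (hek1 : ek < Real.exp (-1))
    (hΦloc : ∀ b : B, ∀ φ ψ : α → ℝ, (∀ x, blk x = cube (Sum.inl b) → φ x = ψ x) → Φ b φ = Φ b ψ)
    (hVloc : ∀ Y : Ys, ∀ φ ψ : α → ℝ, (∀ x, blk x = cube (Sum.inr Y) → φ x = ψ x) → V Y φ = V Y ψ)
    (F : I → (α → ℝ) → ℝ) (hFloc : ∀ i (φ ψ : α → ℝ), (∀ x, blk x = i → φ x = ψ x) → F i φ = F i ψ)
    {L' : Type} [Fintype L'] [DecidableEq L'] {nbar : ℕ} (hL : Fintype.card L' = nbar + 1)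
    (W Bl : Finset I) {Xt : Type*} (𝒳 : Finset Xt) (Vconst PL : ℝ) (W6p W6pp : Finset (Finset I) → Xt → ℝ)
    (h5144 : ∀ ρ ∈ (outer W Bl).filter (IsAdmissible adj), ∀ t ∈ Set.Ioc (0 : ℝ) 1,
      ∀ γ' : L' → ↥(slotB B Ys cube (lam12 W ρ)) ⊕ ↥(slotY B Ys cube (lam12 W ρ)),
      Ineq5144 (cubeSys I) (Finset L')
        (locAct (cubeIn cube (lam12 W ρ) ∘ γ') (prime (g3 adj fun H' => zG blk (interpForm blk Δ (corner ℝ (lam12' adj W ρ))) ℱ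
          (fD (uD χ p ek (slotB B Ys cube (lam12 W ρ)) (fun b : ↥B => Φ b) (fun b : ↥B => c b) (slotY B Ys cube (lam12 W ρ))
            (fun Y : ↥Ys => V Y) t) (cubeIn cube (lam12 W ρ)) γ' H'))))
        Finset.card (fun H (X' : Finset I) => (X' \ H.image (cubeIn cube (lam12 W ρ) ∘ γ')).card) θ β')
    (hrem : ∀ ρ ∈ (outer W Bl).filter (IsAdmissible adj),
      (nbar + 1 : ℝ) * remR (fun t => ∑ γ' : L' → ↥(slotB B Ys cube (lam12 W ρ)) ⊕ ↥(slotY B Ys cube (lam12 W ρ)),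
        Tsum ((polysOf (lam12 W ρ)).image (cvsupp adj (lam12 W ρ))) (locv (cubeIn cube (lam12 W ρ) ∘ γ'))
          (wv (prime (g3 adj fun H' => zG blk (interpForm blk Δ (corner ℝ (lam12' adj W ρ))) ℱ
            (fD (uD χ p ek (slotB B Ys cube (lam12 W ρ)) (fun b : ↥B => Φ b) (fun b : ↥B => c b) (slotY B Ys cube (lam12 W ρ))
              (fun Y : ↥Ys => V Y) t) (cubeIn cube (lam12 W ρ)) γ' H')))) univ) nbar = ∑ X' ∈ 𝒳, W6p ρ X')
    (h311 : ∀ ρ ∈ (outer W Bl).filter (IsAdmissible adj),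
      Vconst + pertP (fun t => Real.log (ztIn blk Δ ℱ χ p ek B Φ c Ys V cube (lam12 W ρ) (lam12' adj W ρ) t)) nbar =
        PL + ∑ X' ∈ 𝒳, W6pp ρ X') :
    Real.exp (-Vconst) * expect blk Δ ℱ (fun i φ => fD (uD χ p ek B Φ c Ys V 1) cube γ ∅ i φ * F i φ) W (corner ℝ W) =
      ∑ ρ ∈ (outer W Bl).filter (IsAdmissible adj),
        (∏ X ∈ ρ, g1 adj (zG blk Δ ℱ (fun i φ => fD (uD χ p ek B Φ c Ys V 1) cube γ ∅ i φ * F i φ)) X) *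
          (zG blk Δ ℱ (fun i φ => fD (uD χ p ek B Φ c Ys V 1) cube γ ∅ i φ * F i φ) (lam12 W ρ) (lam12' adj W ρ) /
              zG blk Δ ℱ (fD (uD χ p ek B Φ c Ys V 1) cube γ ∅) (lam12 W ρ) (lam12' adj W ρ) *
            Real.exp (-PL - ∑ X' ∈ 𝒳, (W6p ρ X' + W6pp ρ X'))) := by
  have hcz : ∀ b ∈ B, Continuous (Φ b) ∧ Φ b 0 = 0 := fun b hb => by
    obtain ⟨ℓ₁, ℓ₂, h₁, h₂, h⟩ := hmod b hb
    exact continuous_and_zero_of_mod h₁ h₂ h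
  refine eq5145_zG blk Δ ℱ adj χ cube γ hΔadj hΔ hχ (by linarith) (fun b hb => (hcz b hb).1) (fun b hb => (hcz b hb).2) hc₀ hcb hV hK
    hek hek1.le hΦloc hVloc F hFloc W Bl 𝒳 Vconst PL
    (fun ρ => pertP (fun t => Real.log (ztIn blk Δ ℱ χ p ek B Φ c Ys V cube (lam12 W ρ) (lam12' adj W ρ) t)) nbar)
    (fun ρ => (nbar + 1 : ℝ) * remR (fun t => ∑ γ' : L' → ↥(slotB B Ys cube (lam12 W ρ)) ⊕ ↥(slotY B Ys cube (lam12 W ρ)),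
        Tsum ((polysOf (lam12 W ρ)).image (cvsupp adj (lam12 W ρ))) (locv (cubeIn cube (lam12 W ρ) ∘ γ'))
          (wv (prime (g3 adj fun H' => zG blk (interpForm blk Δ (corner ℝ (lam12' adj W ρ))) ℱ
            (fD (uD χ p ek (slotB B Ys cube (lam12 W ρ)) (fun b : ↥B => Φ b) (fun b : ↥B => c b) (slotY B Ys cube (lam12 W ρ))
              (fun Y : ↥Ys => V Y) t) (cubeIn cube (lam12 W ρ)) γ' H')))) univ) nbar)
    W6p W6pp (fun ρ hρ => ?_) hrem h311
  rw [zG_fD_empty_eq_ztIn]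
  by_cases hne : Nonempty (↥(slotB B Ys cube (lam12 W ρ)) ⊕ ↥(slotY B Ys cube (lam12 W ρ)))
  swap
  · -- a region without slots (e.g. `Λ₁₂ = ∅` at `ρ = {W}`): `z_t ≡ 1`, the `n̄+1 ≥ 1` labels have no assignment, `𝒫 = 0 = ℛ`
    haveI : IsEmpty (↥(slotB B Ys cube (lam12 W ρ)) ⊕ ↥(slotY B Ys cube (lam12 W ρ))) := not_nonempty_iff.1 hne
    haveI : Nonempty L' := Fintype.card_pos_iff.1 (by omega)
    haveI := isProbabilityMeasure_regionLaw blk Δ ℱ hΔ (lam12 W ρ) (lam12' adj W ρ)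
    have hzt : ∀ t, ztIn blk Δ ℱ χ p ek B Φ c Ys V cube (lam12 W ρ) (lam12' adj W ρ) t = 1 := fun t => by
      simp only [ztIn, zt, Fintype.prod_empty, integral_const, smul_eq_mul, mul_one, probReal_univ]
    simp [hzt, pertP, remR, univ_eq_empty]
  · -- a located slot `s₀` as base point: gen 12's `hmod` model theorem for the located slot data of `Λ₁₂ = lam12 W ρ` and the form `Δ_{1_{Λ₁₂′}}`
    obtain ⟨s₀⟩ := hne
    have hPD := prec_interp_corner_posDef blk Δ hΔ (lam12 W ρ) (lam12' adj W ρ)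
    have h14 := (effectiveAction_fieldLaw_eq_pertP_add_remR_Tsum_of_ineq5144_mod_loc blk (interpForm blk Δ (corner ℝ (lam12' adj W ρ))) ℱ
      (lam12 W ρ) adj χ (B := slotB B Ys cube (lam12 W ρ)) (Φ := fun b : ↥B => Φ b) (c := fun b : ↥B => c b)
      (Ys := slotY B Ys cube (lam12 W ρ)) (V := fun Y : ↥Ys => V Y) (cubeIn cube (lam12 W ρ)) hR hD hnbr hθ0 hθ1 hβ hsmall hχ hp
      (interpForm_abutting blk Δ adj hΔadj (lam12' adj W ρ)) hPD (cubeIn_mem cube (lam12 W ρ)) (fun b φ ψ h => hΦloc b.1 φ ψ h)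
      (fun Y φ ψ h => hVloc Y.1 φ ψ h) (fun b _ => hmod b b.2) hc₀ (fun b _ => hcb b b.2) (fun Y _ => hV Y Y.2)
      (KY := fun Y => KY Y) (fun Y _ φ => hK Y Y.2 φ) hek hek1 hL s₀ (fun _ => s₀) (h5144 ρ hρ)).1
    have hbr : ∀ t, ztIn blk Δ ℱ χ p ek B Φ c Ys V cube (lam12 W ρ) (lam12' adj W ρ) t = _ :=
      fun t => ztIn_eq_zG_located blk Δ ℱ χ cube (lam12 W ρ) (lam12' adj W ρ) (fun _ : L' => s₀) t
    simp only [hbr]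
    exact h14

/-- **(5.14.5) ON THE MODEL FOR BOTH χ-SPECIES OF p. 308, WITH `ℛ_k(Λ₁₂)` ITSELF IN THE EXPONENT, MODULO THE LEAF — THE ROW'S HEAD THEOREM WITH NO
LINEARITY HYPOTHESIS ON THE SLOT FIELDS**: gen 12's `BIJ88Eq5145CornerNoncentred.eq5145_zG_linear_remR_of_ineq5144'` (`exp(−𝒫^L − Σ_X W₆″(X) −
ℛ_k(Λ₁₂))`, `ℛ_k(Λ₁₂) := (n̄+1)·remR(t ↦ Σ_γ T_{γ,t})`, display 4 read as the definition of the `W₆′` sum) with `hlin` WEAKENED to `hmod`: each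
slot field `Φ_b` a linear functional (a component of `(I−Q^{s*}Q)A^{(k)}`) OR a modulus of two linear functionals (`|φ^{(k)}(x)| = √(Re²+Im²)`,
(5.2.1) p. 278), every source `ℱ`, no centring; displayed per region ONLY the located leaf (5.14.4) `h5144` and p. 311 `h311` (`𝒳` any index set
with a member `X₀`; no base point). [cite: BalabanImbrieJaffe1988, (5.14.5) p.312; (5.14.2) p.308; p.310 displays 3–4; (5.14.4) p.309; (5.2.1) p.278] -/
theorem eq5145_zG_mod_remR_of_ineq5144_loc {nbr : I → Finset I} {D : ℕ} {θ β' : ℝ} (hR : ∀ x y, adj x y → adj y x)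
    (hD : ∀ x, (nbr x).card ≤ D) (hnbr : ∀ x y, adj x y → y ∈ nbr x) (hθ0 : 0 < θ) (hθ1 : θ ≤ 1) (hβ : 0 ≤ β')
    (hsmall : 16 * ((D : ℝ) + 1) ^ 2 * (θ ^ (β' / 2) * Real.exp 2) ≤ 1)
    (hΔadj : ∀ x y, blk x ≠ blk y → ¬ adj (blk x) (blk y) → Δ x y = 0) (hΔ : Δ.PosDef)
    (hχ : ∀ x, 0 ≤ χ.χ₁ x) (hp : 1 / 2 < p)
    (hmod : ∀ b ∈ B, ∃ ℓ₁ ℓ₂ : (α → ℝ) → ℝ, IsLinearMap ℝ ℓ₁ ∧ IsLinearMap ℝ ℓ₂ ∧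
      ((∀ φ, Φ b φ = ℓ₁ φ) ∨ (∀ φ, Φ b φ = Real.sqrt (ℓ₁ φ ^ 2 + ℓ₂ φ ^ 2))))
    {c₀ : ℝ} (hc₀ : 0 < c₀) (hcb : ∀ b ∈ B, c₀ ≤ c b) (hV : ∀ Y ∈ Ys, Measurable (V Y)) {KY : υ → ℝ} (hK : ∀ Y ∈ Ys, ∀ φ, |V Y φ| ≤ KY Y)
    (hek : 0 < ek) (hek1 : ek < Real.exp (-1))
    (hΦloc : ∀ b : B, ∀ φ ψ : α → ℝ, (∀ x, blk x = cube (Sum.inl b) → φ x = ψ x) → Φ b φ = Φ b ψ)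
    (hVloc : ∀ Y : Ys, ∀ φ ψ : α → ℝ, (∀ x, blk x = cube (Sum.inr Y) → φ x = ψ x) → V Y φ = V Y ψ)
    (F : I → (α → ℝ) → ℝ) (hFloc : ∀ i (φ ψ : α → ℝ), (∀ x, blk x = i → φ x = ψ x) → F i φ = F i ψ)
    {L' : Type} [Fintype L'] [DecidableEq L'] {nbar : ℕ} (hL : Fintype.card L' = nbar + 1)
    (W Bl : Finset I) {Xt : Type*} [DecidableEq Xt] (𝒳 : Finset Xt) {X₀ : Xt} (hX₀ : X₀ ∈ 𝒳) (Vconst PL : ℝ)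
    (W6pp : Finset (Finset I) → Xt → ℝ)
    (h5144 : ∀ ρ ∈ (outer W Bl).filter (IsAdmissible adj), ∀ t ∈ Set.Ioc (0 : ℝ) 1,
      ∀ γ' : L' → ↥(slotB B Ys cube (lam12 W ρ)) ⊕ ↥(slotY B Ys cube (lam12 W ρ)),
      Ineq5144 (cubeSys I) (Finset L')
        (locAct (cubeIn cube (lam12 W ρ) ∘ γ') (prime (g3 adj fun H' => zG blk (interpForm blk Δ (corner ℝ (lam12' adj W ρ))) ℱ
          (fD (uD χ p ek (slotB B Ys cube (lam12 W ρ)) (fun b : ↥B => Φ b) (fun b : ↥B => c b) (slotY B Ys cube (lam12 W ρ))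
            (fun Y : ↥Ys => V Y) t) (cubeIn cube (lam12 W ρ)) γ' H'))))
        Finset.card (fun H (X' : Finset I) => (X' \ H.image (cubeIn cube (lam12 W ρ) ∘ γ')).card) θ β')
    (h311 : ∀ ρ ∈ (outer W Bl).filter (IsAdmissible adj),
      Vconst + pertP (fun t => Real.log (ztIn blk Δ ℱ χ p ek B Φ c Ys V cube (lam12 W ρ) (lam12' adj W ρ) t)) nbar =
        PL + ∑ X' ∈ 𝒳, W6pp ρ X') :
    Real.exp (-Vconst) * expect blk Δ ℱ (fun i φ => fD (uD χ p ek B Φ c Ys V 1) cube γ ∅ i φ * F i φ) W (corner ℝ W) =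
      ∑ ρ ∈ (outer W Bl).filter (IsAdmissible adj),
        (∏ X ∈ ρ, g1 adj (zG blk Δ ℱ (fun i φ => fD (uD χ p ek B Φ c Ys V 1) cube γ ∅ i φ * F i φ)) X) *
          (zG blk Δ ℱ (fun i φ => fD (uD χ p ek B Φ c Ys V 1) cube γ ∅ i φ * F i φ) (lam12 W ρ) (lam12' adj W ρ) /
              zG blk Δ ℱ (fD (uD χ p ek B Φ c Ys V 1) cube γ ∅) (lam12 W ρ) (lam12' adj W ρ) *
            Real.exp (-PL - ∑ X' ∈ 𝒳, W6pp ρ X' -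
              (nbar + 1 : ℝ) * remR (fun t => ∑ γ' : L' → ↥(slotB B Ys cube (lam12 W ρ)) ⊕ ↥(slotY B Ys cube (lam12 W ρ)),
                Tsum ((polysOf (lam12 W ρ)).image (cvsupp adj (lam12 W ρ))) (locv (cubeIn cube (lam12 W ρ) ∘ γ'))
                  (wv (prime (g3 adj fun H' => zG blk (interpForm blk Δ (corner ℝ (lam12' adj W ρ))) ℱ
                    (fD (uD χ p ek (slotB B Ys cube (lam12 W ρ)) (fun b : ↥B => Φ b) (fun b : ↥B => c b)
                      (slotY B Ys cube (lam12 W ρ)) (fun Y : ↥Ys => V Y) t) (cubeIn cube (lam12 W ρ)) γ' H')))) univ) nbar)) := by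
  have h := eq5145_zG_mod_Tsum_of_ineq5144_loc blk Δ ℱ adj χ cube γ hR hD hnbr hθ0 hθ1 hβ hsmall hΔadj hΔ hχ hp hmod hc₀ hcb hV hK
    hek hek1 hΦloc hVloc F hFloc hL W Bl 𝒳 Vconst PL
    (fun ρ X' => if X' = X₀ then (nbar + 1 : ℝ) * remR (fun t => ∑ γ' : L' → ↥(slotB B Ys cube (lam12 W ρ)) ⊕ ↥(slotY B Ys cube (lam12 W ρ)),
        Tsum ((polysOf (lam12 W ρ)).image (cvsupp adj (lam12 W ρ))) (locv (cubeIn cube (lam12 W ρ) ∘ γ'))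
          (wv (prime (g3 adj fun H' => zG blk (interpForm blk Δ (corner ℝ (lam12' adj W ρ))) ℱ
            (fD (uD χ p ek (slotB B Ys cube (lam12 W ρ)) (fun b : ↥B => Φ b) (fun b : ↥B => c b)
              (slotY B Ys cube (lam12 W ρ)) (fun Y : ↥Ys => V Y) t) (cubeIn cube (lam12 W ρ)) γ' H')))) univ) nbar else 0)
    W6pp h5144 (fun ρ _ => by rw [sum_ite_eq' 𝒳 X₀, if_pos hX₀]) h311
  simp only [sum_add_ite_eq 𝒳 hX₀] at h
  rw [h]
  refine sum_congr rfl fun ρ _ => ?_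
  congr 2
  ring_nf

/-! ## §3 THE HEAD THEOREM with `exp[−𝒫^L − Σ_X (W₆′ + W₆″)]` and r16's `IneqW6'` for its `W₆′`, from the located leaf (gen 13 `BIJ88Eq5145CornerW6`) -/

/-- **(5.14.5) ON THE MODEL WITH `exp[−𝒫^L − Σ_X (W₆^{(k)′}(X) + W₆^{(k)″}(X))]`, `W₆′` AS PRINTED, MODULO THE LEAF (5.14.4)** (p. 311 [PDF 55]:
*"If we put W₆^{(k)}(X) = W₆^{(k)′}(X) + W₆^{(k)″}(X), then W₆^{(k)}(X) obeys …"*; p. 310 display 4 and the sentence defining `W₆′`): the head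
theorem of row C2.Eq5.14.5 (`BIJ88Eq5145CornerModulus.eq5145_zG_mod_Tsum_of_ineq5144_loc`, index set `𝒳 := univ : Finset (Finset I)`) with
`W6p ρ := W6v` of `Λ₁₂ = lam12 W ρ` at `1_{lam12' adj W ρ}` and its `hrem` DISCHARGED by display 4 derived (`BIJ88W6PrimeVsupp.remR_sum_Tsum_eq_sum_W6v_loc`;
`W6v` vanishes off the sub-regions of `Λ₁₂`).  Hypotheses: gen 5's regime, `Δ ≻ 0` coupling abutting cubes only, `χ ≥ 0`, `p > 1/2`, linear-or-modulus
cube-local slot fields (`hmod`), `c_b ≥ c₀ > 0`, measurable bounded cube-local terms, `0 < e_k < e^{−1}`, cube-local `F`, `|L'| = n̄+1`; per region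
(no base point): the located leaf for the located data of EVERY SUB-REGION of `Λ₁₂` at every `t ∈ (0,1]`, `h311`.
[cite: BalabanImbrieJaffe1988, (5.14.5) p.312; p.310 display 4; (5.14.2) p.308; (5.14.4) p.309; p.311] -/
theorem eq5145_zG_mod_W6v_of_ineq5144_loc {nbr : I → Finset I} {D : ℕ} {θ β' : ℝ} (hR : ∀ x y, adj x y → adj y x)
    (hD : ∀ x, (nbr x).card ≤ D) (hnbr : ∀ x y, adj x y → y ∈ nbr x) (hθ0 : 0 < θ) (hθ1 : θ ≤ 1) (hβ : 0 ≤ β')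
    (hsmall : 16 * ((D : ℝ) + 1) ^ 2 * (θ ^ (β' / 2) * Real.exp 2) ≤ 1)
    (hΔadj : ∀ x y, blk x ≠ blk y → ¬ adj (blk x) (blk y) → Δ x y = 0) (hΔ : Δ.PosDef)
    (hχ : ∀ x, 0 ≤ χ.χ₁ x) (hp : 1 / 2 < p)
    (hmod : ∀ b ∈ B, ∃ ℓ₁ ℓ₂ : (α → ℝ) → ℝ, IsLinearMap ℝ ℓ₁ ∧ IsLinearMap ℝ ℓ₂ ∧
      ((∀ φ, Φ b φ = ℓ₁ φ) ∨ (∀ φ, Φ b φ = Real.sqrt (ℓ₁ φ ^ 2 + ℓ₂ φ ^ 2))))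
    {c₀ : ℝ} (hc₀ : 0 < c₀) (hcb : ∀ b ∈ B, c₀ ≤ c b) (hV : ∀ Y ∈ Ys, Measurable (V Y)) {KY : υ → ℝ} (hK : ∀ Y ∈ Ys, ∀ φ, |V Y φ| ≤ KY Y)
    (hek : 0 < ek) (hek1 : ek < Real.exp (-1))
    (hΦloc : ∀ b : B, ∀ φ ψ : α → ℝ, (∀ x, blk x = cube (Sum.inl b) → φ x = ψ x) → Φ b φ = Φ b ψ)
    (hVloc : ∀ Y : Ys, ∀ φ ψ : α → ℝ, (∀ x, blk x = cube (Sum.inr Y) → φ x = ψ x) → V Y φ = V Y ψ)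
    (F : I → (α → ℝ) → ℝ) (hFloc : ∀ i (φ ψ : α → ℝ), (∀ x, blk x = i → φ x = ψ x) → F i φ = F i ψ)
    {L' : Type} [Fintype L'] [DecidableEq L'] {nbar : ℕ} (hL : Fintype.card L' = nbar + 1)
    (W Bl : Finset I) (Vconst PL : ℝ) (W6pp : Finset (Finset I) → Finset I → ℝ)
    (h5144 : ∀ ρ ∈ (outer W Bl).filter (IsAdmissible adj), ∀ X' ⊆ lam12 W ρ, ∀ t ∈ Set.Ioc (0 : ℝ) 1,
      ∀ γ' : L' → ↥(slotB B Ys cube X') ⊕ ↥(slotY B Ys cube X'),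
      Ineq5144 (cubeSys I) (Finset L') (locAct (cubeIn cube X' ∘ γ') (actIn blk Δ ℱ adj χ p ek B Φ c Ys V cube (lam12' adj W ρ) X' t γ'))
        Finset.card (fun H (X'' : Finset I) => (X'' \ H.image (cubeIn cube X' ∘ γ')).card) θ β')
    (h311 : ∀ ρ ∈ (outer W Bl).filter (IsAdmissible adj),
      Vconst + pertP (fun t => Real.log (ztIn blk Δ ℱ χ p ek B Φ c Ys V cube (lam12 W ρ) (lam12' adj W ρ) t)) nbar =
        PL + ∑ X' : Finset I, W6pp ρ X') :
    Real.exp (-Vconst) * expect blk Δ ℱ (fun i φ => fD (uD χ p ek B Φ c Ys V 1) cube γ ∅ i φ * F i φ) W (corner ℝ W) =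
      ∑ ρ ∈ (outer W Bl).filter (IsAdmissible adj),
        (∏ X ∈ ρ, g1 adj (zG blk Δ ℱ (fun i φ => fD (uD χ p ek B Φ c Ys V 1) cube γ ∅ i φ * F i φ)) X) *
          (zG blk Δ ℱ (fun i φ => fD (uD χ p ek B Φ c Ys V 1) cube γ ∅ i φ * F i φ) (lam12 W ρ) (lam12' adj W ρ) /
              zG blk Δ ℱ (fD (uD χ p ek B Φ c Ys V 1) cube γ ∅) (lam12 W ρ) (lam12' adj W ρ) *
            Real.exp (-PL - ∑ X' : Finset I,
              (W6v blk Δ ℱ adj χ p ek B Φ c Ys V cube (lam12' adj W ρ) (lam12 W ρ) L' nbar X' + W6pp ρ X'))) :=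
  eq5145_zG_mod_Tsum_of_ineq5144_loc blk Δ ℱ adj χ cube γ hR hD hnbr hθ0 hθ1 hβ hsmall hΔadj hΔ hχ hp hmod hc₀ hcb hV hK hek hek1 hΦloc hVloc
    F hFloc hL W Bl (univ : Finset (Finset I)) Vconst PL (fun ρ X' => W6v blk Δ ℱ adj χ p ek B Φ c Ys V cube (lam12' adj W ρ) (lam12 W ρ) L' nbar X')
    W6pp (fun ρ hρ t ht γ' => h5144 ρ hρ (lam12 W ρ) Subset.rfl t ht γ') (fun ρ hρ => by
      rw [remR_sum_Tsum_eq_sum_W6v_loc blk Δ ℱ adj χ (lam12' adj W ρ) hR hD hnbr hθ0 hθ1 hβ hsmall hχ hp hΔadj hΔ hΦloc hVloc hmod hc₀ hcb hV hK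
        hek hek1 (lam12 W ρ) L' hL (h5144 ρ hρ)]
      exact sum_subset (subset_univ _) fun X' _ hX' =>
        W6v_eq_zero_of_not_subset blk Δ ℱ adj χ (lam12' adj W ρ) (fun h => hX' (mem_powerset.2 h)) L' nbar) h311

/-- **THE PRINTED BOUND FOR THE `W₆′` OF EVERY REGION, MODULO (5.14.4)**: for every admissible `ρ`, r16's typed leaf
`IneqW6' (cubeSys I) W₆′_ρ (θ^{1−β′}) (β′/(4(1−β′))) n̄` for the `W₆′_ρ = W6v` of the previous theorem's exponent (`BIJ88W6PrimeVsuppBound.ineqW6'_W6v_loc`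
for `W₀ = lam12 W ρ`, `Λ = lam12' adj W ρ`): at most `G` slots (χ-slots `b ∈ B` and terms `Y ∈ Ys` of p. 308 together) per cube, `β′ < 1`, the
absorption condition, the located leaf for the data of `Λ₁₂` at every `t ∈ (0,1]` — the `hW6p` input of r16's
`BIJ88IneqW6FromLeaves.ineqW6_of_leaves` (p. 311). [cite: BalabanImbrieJaffe1988, p.310 (Sect. 5.14); (5.14.4) p.309; p.311] -/
theorem ineqW6'_W6v_region_loc {nbr : I → Finset I} {D : ℕ} {θ β' : ℝ} (hR : ∀ x y, adj x y → adj y x)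
    (hD : ∀ x, (nbr x).card ≤ D) (hnbr : ∀ x y, adj x y → y ∈ nbr x) (hθ0 : 0 < θ) (hθ1 : θ ≤ 1) (hβ : 0 ≤ β') (hβ1 : β' < 1)
    (hsmall : 16 * ((D : ℝ) + 1) ^ 2 * (θ ^ (β' / 2) * Real.exp 2) ≤ 1) [Fintype ι] [Fintype υ] {G : ℕ}
    (hG : ∀ i, (univ.filter fun τ : ↥B ⊕ ↥Ys => cube τ = i).card ≤ G)
    {L' : Type} [Fintype L'] [DecidableEq L'] {nbar : ℕ} (hL : Fintype.card L' = nbar + 1)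
    (habs : 4 * Real.exp 2 * θ ^ (β' / 2) * ((D : ℝ) + 1) * (nbar + 1 : ℝ) * (G : ℝ) ^ (nbar + 1) * (nbar + 2).factorial ≤
      (β' / 4 * Real.log θ⁻¹) ^ (nbar + 2))
    (W Bl : Finset I)
    (h5144 : ∀ ρ ∈ (outer W Bl).filter (IsAdmissible adj), ∀ t ∈ Set.Ioc (0 : ℝ) 1,
      ∀ γ' : L' → ↥(slotB B Ys cube (lam12 W ρ)) ⊕ ↥(slotY B Ys cube (lam12 W ρ)),
      Ineq5144 (cubeSys I) (Finset L') (locAct (cubeIn cube (lam12 W ρ) ∘ γ') (actIn blk Δ ℱ adj χ p ek B Φ c Ys V cube (lam12' adj W ρ) (lam12 W ρ) t γ'))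
        Finset.card (fun H (X'' : Finset I) => (X'' \ H.image (cubeIn cube (lam12 W ρ) ∘ γ')).card) θ β') :
    ∀ ρ ∈ (outer W Bl).filter (IsAdmissible adj),
      IneqW6' (cubeSys I) (W6v blk Δ ℱ adj χ p ek B Φ c Ys V cube (lam12' adj W ρ) (lam12 W ρ) L' nbar) (θ ^ (1 - β'))
        (β' / (4 * (1 - β'))) nbar :=
  fun ρ hρ => ineqW6'_W6v_loc blk Δ ℱ adj χ (lam12' adj W ρ) hR hD hnbr hθ0 hθ1 hβ hβ1 hsmall (lam12 W ρ)
    (fun i => (card_filter_cubeIn_le (cube := cube) (lam12 W ρ) i).trans (hG i)) L' hL habs (h5144 ρ hρ)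


end Literature.MathematicalPhysics.QuantumFieldTheory.BalabanImbrieJaffe1984to88.BIJ88Eq5145CornerW6Loc

end
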